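import Summits.CriticalPhenomena.CardyFormulaZ2.Theses.CardyBoundaryCoulombGas
import Summits.CriticalPhenomena.CardyFormulaZ2.Theorems.CardyBoundaryCoulombGasRectilinearCardyDefs
import Summits.CriticalPhenomena.CardyFormulaZ2.Theorems.CardyBoundaryCoulombGasRectilinearCardyStubBetaRatioIdentity
import Summits.CriticalPhenomena.CardyFormulaZ2.Theorems.CardyBoundaryCoulombGasRectilinearCardyStubFiniteCorners
import Summits.CriticalPhenomena.CardyFormulaZ2.Theorems.CardyBoundaryCoulombGasRectilinearCardyStubBoundaryArmTightness
import Summits.CriticalPhenomena.CardyFormulaZ2.Theorems.CardyBoundaryCoulombGasRectilinearCardyUniformFlatRadius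
import Summits.CriticalPhenomena.CardyFormulaZ2.Theorems.CardyBoundaryCoulombGasRectilinearCardyLocalToGlobal2
import Summits.CriticalPhenomena.CardyFormulaZ2.Theorems.CardyBoundaryCoulombGasRectilinearCardyKernelMassPos

/-!
# `RectilinearCardy` from the two open laws of the line `excursion-kernel-covariance`
# (crux stmt-CriticalPhenomena-5660, route `CardyBoundaryCoulombGas`, sub-problem `CardyFormulaZ2`)

CONDITIONAL ASSEMBLY (lead `prover-line-stmt-CriticalPhenomena-5660-0`, 2026-08-16). The line skeleton
`Cruxes/RectilinearCardy/Lines/excursion_kernel_covariance.lean` reduces the crux — Cardy's formula for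
bond-`ℤ²` percolation at `p = 1/2` in every rectilinear conformal rectangle — to six stubs; four of them
are now tree theorems (`stub_betaRatioIdentity` p84918, `stub_finiteCorners` p85706,
`stub_boundaryArmTightness` p95609, the abstract gluing `localToGlobal_abstract` p90556 with
`exists_uniform_flatRadius` p88921, and part (b) of the kernel stub, `eventually_kernelMass_mark_one_pos`
p96020). This file records, SORRY-FREE and in the tree, what is left: the
crux follows from exactly two explicit hypotheses, stated over the line's vocabulary
(`Theorems/CardyBoundaryCoulombGasRectilinearCardyDefs.lean`):

* `h₁` = the CUBE-ROOT LAW (macroscopic shadow; the lever, OPEN — modulo `h₃` it is Cardy's formula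
  for the sub-rectangles `(Ω; a, b, boundary s, d)` with `s` on a flat stretch): on pairs of fixed
  windows inside flat, mark-free parameter ranges the increments of the tail crossing probability
  `Q_δ = tailCrossingProb R δ` and of the self-normalised cube-root kernel mass
  `ν_δ = kernelTailFraction R δ` satisfy the double-ratio law with ONE constant for all sides;
* `h₃` = the KERNEL CONVERGENCE (classical discrete potential theory, not yet in the tree:
  Kozdron–Lawler's excursion-Poisson-kernel asymptotics, KozdronLawler2005 Thm 1.1, plus weak convergence
  of the discrete harmonic measure of lattice polygons): the `ν_δ`-measure has no atoms, vanishing tail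
  at `d`, and `ν_δ(mark 2) → betaRatio x` for some uniformizing datum (positivity of its total mass is
  the tree theorem `eventually_kernelMass_mark_one_pos`, p96020).

Nothing here is claimed as a proof of the item: the theorem is a conditional (its type is
`h₁ → h₃ → RectilinearCardy`); it is the kernel-checked form of "crux closed modulo
{`stub_cubeRootLaw`, `stub_kernelScalingLimit`}".
-/

noncomputable section

open Set Filter Topology MeasureTheory
open Literature.Probability.RandomPlanarGeometry
open Literature.Probability.Percolation (bondDomainCrossingProb discreteCrossingProb half)
open Literature.Probability.LatticeModels (Site meshPoint meshDomain meshBoundary discreteArc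
  meshDomain_finite dirichletGreen)
open Summit.CriticalPhenomena.CardyFormulaZ2.Theorems.RectilinearCardy.Negative (IsRectilinear)
open Summit.CriticalPhenomena.CardyFormulaZ2.Theses.CardyBoundaryCoulombGas (RectilinearCardy)

namespace Summit.CriticalPhenomena.CardyFormulaZ2.Cruxes.RectilinearCardy.ExcursionKernelCovariance

/-- **The crux from the two open laws.** `RectilinearCardy` (Cardy's formula for bond-`ℤ²` at
`p = 1/2` in every rectilinear conformal rectangle) follows from (h₁) the cube-root law on flat
windows and (h₃) the kernel scaling limit, everything else being tree theorems: finite corners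
(`stub_finiteCorners`), RSW boundary-arm tightness (`stub_boundaryArmTightness`), the abstract
local-to-global gluing (`localToGlobal_abstract`, `exists_uniform_flatRadius`), the beta-ratio identity
(`stub_betaRatioIdentity`), datum-independence of the cross-ratio
(`ConformalRectangle.crossRatio_eq_of_isUniformizing_holds`) and `Q_δ(mark 2) = bondDomainCrossingProb R δ`
(`tailCrossingProb_mark_two`). CONDITIONAL: `h₁` is open (crux-sized), `h₃` is classical but
unformalised. [folklore] -/
theorem rectilinearCardy_of_cubeRootLaw_of_kernelScalingLimit
    (h₁ : ∀ R : ConformalRectangle, IsRectilinear R →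
      ∀ σ σ' τ τ' : ℝ, AdmissibleRange R σ σ' → AdmissibleRange R τ τ' →
        ∀ ε : ℝ, 0 < ε → ∀ s s' t t' : ℝ,
          σ ≤ s → s ≤ s' → s' ≤ σ' → τ ≤ t → t ≤ t' → t' ≤ τ' → ∀ᶠ δ in 𝓝[>] (0 : ℝ),
            |(tailCrossingProb R δ s - tailCrossingProb R δ s') *
                  (kernelTailFraction R δ t - kernelTailFraction R δ t') -
                (tailCrossingProb R δ t - tailCrossingProb R δ t') *
                  (kernelTailFraction R δ s - kernelTailFraction R δ s')|
              ≤ ε * ((tailCrossingProb R δ s - tailCrossingProb R δ s') *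
                  (kernelTailFraction R δ t - kernelTailFraction R δ t') +
                (tailCrossingProb R δ t - tailCrossingProb R δ t') *
                  (kernelTailFraction R δ s - kernelTailFraction R δ s')))
    (h₃ : ∀ R : ConformalRectangle, IsRectilinear R →
      (∀ ε : ℝ, 0 < ε → ∃ ρ : ℝ, 0 < ρ ∧ ∀ᶠ δ in 𝓝[>] (0 : ℝ), ∀ s s' : ℝ,
          R.mark 1 ≤ s → s ≤ s' → s' ≤ R.mark 3 → Metric.diam (R.boundary '' Icc s s') ≤ ρ →
            kernelTailFraction R δ s - kernelTailFraction R δ s' ≤ ε) ∧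
        Tendsto (fun δ => kernelTailFraction R δ (R.mark 3)) (𝓝[>] 0) (𝓝 0) ∧
        ∃ (φ : ConformalEquiv UpperHalfPlane.upperHalfPlaneSet R.carrier) (x : Fin 4 → ℝ),
          R.IsUniformizing φ x ∧
            Tendsto (fun δ => kernelTailFraction R δ (R.mark 2)) (𝓝[>] 0) (𝓝 (betaRatio x))) :
    RectilinearCardy := by
  intro R hR φ' x' hφx'
  obtain ⟨hνtight, hν3, φ, x, hφx, hν⟩ := h₃ R hR
  have hpos : ∀ᶠ δ in 𝓝[>] (0 : ℝ), 0 < kernelMass R δ (R.mark 1) :=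
    eventually_kernelMass_mark_one_pos R
  obtain ⟨T, hT⟩ := stub_finiteCorners R hR
  obtain ⟨hQtight, hQ1, hQ3⟩ := stub_boundaryArmTightness R hR
  -- the gluing lemma at `s = mark 2`
  have hG : Tendsto (fun δ => tailCrossingProb R δ (R.mark 2) - kernelTailFraction R δ (R.mark 2))
      (𝓝[>] 0) (𝓝 0) := by
    have h13 : R.mark 1 < R.mark 3 := R.strictMono_mark (show (1 : Fin 4) < 3 by decide)
    have hδpos : ∀ᶠ δ in 𝓝[>] (0 : ℝ), 0 < δ := eventually_mem_nhdsWithin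
    refine localToGlobal_abstract (Q := fun δ s => tailCrossingProb R δ s)
      (ν := fun δ s => kernelTailFraction R δ s)
      (Good := fun s => ∃ r : ℝ, 0 < r ∧ FlatNear R (R.boundary s) r) (Adm := AdmissibleRange R)
      h13 R.continuous_boundary T hT ?_ ?_ ?_ ?_ ?_ hQ1 hQ3 hν3 hQtight hνtight (h₁ R hR)
      (R.mark 2) (mark_two_mem_Icc R)
    · intro σ σ' hσ hσσ' hσ' hgood
      exact ⟨hσ, hσσ', hσ', exists_uniform_flatRadius R hgood⟩
    · exact Eventually.of_forall fun δ a ha b hb hab => tailCrossingProb_antitone R δ ha.1 hab hb.2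
    · filter_upwards [hpos, hδpos] with δ hp hδ a ha b hb hab
      exact div_le_div_of_nonneg_right (kernelMass_antitone R hδ ha.1 hab hb.2) hp.le
    · exact Eventually.of_forall fun δ => measureReal_le_one
    · filter_upwards [hpos] with δ hp
      exact div_self hp.ne'
  have hQ : Tendsto (fun δ => tailCrossingProb R δ (R.mark 2)) (𝓝[>] 0) (𝓝 (betaRatio x)) := by
    have := hG.add hν
    simp only [sub_add_cancel, zero_add] at this
    exact this
  rw [show betaRatio x = cardyFunction (crossRatio x) from stub_betaRatioIdentity x hφx.1] at hQ
  rw [ConformalRectangle.crossRatio_eq_of_isUniformizing_holds hφx' hφx]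
  refine hQ.congr fun δ => ?_
  exact tailCrossingProb_mark_two R δ

end Summit.CriticalPhenomena.CardyFormulaZ2.Cruxes.RectilinearCardy.ExcursionKernelCovariance

end
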